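import Literature.MathematicalPhysics.QuantumLattice.DWaveKomaTasakiSystem
import Literature.MathematicalPhysics.QuantumLattice.KomaTasakiU1FieldEnergy
import Literature.MathematicalPhysics.QuantumLattice.DWaveOrderParameterProofs
import HarnessLib

/-!
# Koma–Tasaki 1993 Theorem 7.3 for the `d`-wave pair field of the two-dimensional Hubbard model:
# ground-state pair long-range order ⟹ sourced `d`-wave order `≥ σ/√2` (tree normalisation), BY NAME

T. Koma, H. Tasaki, Commun. Math. Phys. **158** (1993) 191–214 (`KomaTasaki1993`), Theorem 7.3 (7.11)
("… allows one to apply the theorem to … the electron pair condensation problems in lattice electron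
systems", p. 211) and J. Stat. Phys. **76** (1994) 745–803 (`KomaTasaki1994`), §1 (0.2) (the sourced order
parameter, volume limit FIRST), §3.3–3.4 (Hubbard model, pairing order operators), Theorem 2.5 (2.30):

  if the symmetric ground states `Φ_Λ` have long-range order `σ = lim N⁻¹√(Φ_Λ,(O_Λ)²Φ_Λ) > 0` then every
  ground state `Φ_Λ(B)` of `H_Λ - B O_Λ` has `liminf_{B↓0} liminf_Λ N⁻¹(Φ_Λ(B), O_Λ Φ_Λ(B)) ≥ √2 σ`.

Here `O_Λ = Δ_d + Δ_d†` (`Δ_d = pairField dWaveFormFactor L`, the `d_{x²-y²}` pair field of the torus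
`(ℤ/Lℤ)²`), `H_Λ = H(1,U) - μN` (`hubbardTorusWith 2 L 1 U μ`), `H_Λ - B O_Λ = dWaveSourceTorus L U μ B`, and
the tree's order-parameter density `dWaveSourceDensity L U μ B = Re ω_B(Δ_d)/L²` is HALF of Koma–Tasaki's
`N⁻¹ ω_B(O_Λ)`; so with `σ_Λ := √(Re Φ†(Δ_d+Δ_d†)²Φ)/L² ≥ s` the printed `√2 σ` reads `2·m_L(B) ≥ √2 s`,
i.e. `m_L(B) ≥ s/√2`.

## What this file proves (sorry-free; every hypothesis a finite-volume matrix statement)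

All three statements are assembled BY NAME from the abstract Koma–Tasaki theorems of the tree applied to
the instance `dWaveKTSystem` (`DWaveKomaTasakiSystem.lean`: the Hubbard torus with `Δ_g` IS a bounded-overlap
`U(1)` system, `o = 2K_d`, `K_d = pairNormConst dWaveFormFactor`, `r = r′ = 25`, `h̄ = 45(2+|U|+2|μ|)`):

* `re_pairOrder_groundStateVector_ge_of_pairLRO` — ORDER form for ground-state VECTORS (from
  `komaTasakiU1Field_holds`, KT93 (7.5)+(7.11)): ∀ `s ∈ (0, 2K_d]`, `B > 0`, `ε > 0` ∃ `L₀` ∀ `L ≥ L₀`: a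
  normalised particle-number-eigenvector ground state `Φ` of `H(1,U) - μN` with `(sL²)² ≤ Re Φ†(Δ_d+Δ_d†)²Φ`
  forces EVERY normalised ground-state vector `Φ_B` of `dWaveSourceTorus L U μ B` to have
  `Re Φ_B†(Δ_d+Δ_d†)Φ_B / L² ≥ √2 s - ε`;
* `two_mul_dWaveSourceDensity_ge_of_pairLRO` — TRACIAL form (from the ENERGY form
  `U1OverlapSystem.field_energy_le_of_card_ge`, KT93 (7.4)+(7.24), the variational principle and the
  concavity sandwich `E_L(0) - E_L(B) ≤ B·Re ω_B(Δ_d+Δ_d†)` of `GroundStateSourceBounds`): same hypotheses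
  ⟹ `2·dWaveSourceDensity L U μ B ≥ √2 s - ε`;
* `le_dWaveOrderParameter_of_pairLRO` — the Koma–Tasaki ORDER PARAMETER of the tree: pair LRO at level `s`
  in normalised particle-number-eigenvector ground states along the tori, eventually in `L`, gives
  `dWaveOrderParameter U μ ≥ √2 s/2 = s/√2` (volume limit first, then `h ↓ 0`, `le_dWaveOrderParameter_iff_forall`).

Read contrapositively the last statement is the KT-direction CEILING on ground-state pair long-range
order from the sourced order parameter: `s ≤ √2 · dWaveOrderParameter U μ` (cell `pub/hubbard-cq`,
CQ-TABLE row B2(b); the Kaplan–Horsch–von der Linden engine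
`Summit.HubbardSuperconductivity.…AbsenceCertificate.SourcedOrderDominatesLRO` gives the weaker factor).
The converse (sourced order ⟹ LRO) is not a theorem
(`Literature.Barriers.HubbardSuperconductivity.SourcedOrderWithoutGroundStateLRO`,
`…FiniteFieldResponseWithoutLRO`).

Conventions.  `DecidableEq (FermionTorus 2 L)` is `LinearOrder.toDecidableEq` throughout (the instance
`instDecidableEqFermionTorusKT` of `DWaveKomaTasakiSystem.lean`, re-activated locally), as in the cell's node
files; `Matrix.IsGroundStateVector` / `Matrix.groundEnergy` hypotheses are stated with it.
`dWaveSourceDensity`, `dWaveOrderParameter` carry no instance.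

## Mathlib / tree search

Reused: `dWaveKTSystem`, `dWaveKTSystem_isLROEigenstate`, `dWaveKTSystem_hamiltonian/_order_zero/_field/
_hbar/_r/_r'`, `groundEnergy_le_re_inner_toEuclideanCLM`, `re_inner_le_of_groundState`,
`pairNormConst_dWave_pos` (`DWaveKomaTasakiSystem`); `komaTasakiU1Field_holds` (`KomaTasakiU1FieldBound`),
`U1OverlapSystem.field_energy_le_of_card_ge` (`KomaTasakiU1FieldEnergy`),
`theorem_2_5_orderOne_overlap_holds` (`KomaTasakiSSBOverlap`); `sub_groundEnergy_le_sub_mul_re_groundStateFunctional`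
(`GroundStateSourceBounds`), `re_groundStateFunctional_dWaveSource_op`, `dWaveSourceTorus_isHermitian`,
`isHermitian_pairField_add_conjTranspose`, `isHermitian_hubbardTorusWith` (`DWaveSource*`),
`le_dWaveOrderParameter_iff_forall`, `dWaveSourceDensity_le_const` (`DWaveOrderParameterProofs`);
Mathlib `Filter.le_liminf_of_le`, `Filter.isCoboundedUnder_ge_of_eventually_le`.
-/

noncomputable section

open Matrix Complex Finset WithLp Literature.Probability.LatticeModels
open Literature.Barriers.HubbardSuperconductivity
open scoped Matrix.Norms.L2Operator InnerProductSpace ComplexConjugate ComplexOrder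

namespace Literature.MathematicalPhysics.QuantumLattice

open KomaTasaki DWaveKT Filter
open scoped Topology

attribute [local instance 10000] instDecidableEqFermionTorusKT

section DWaveField

variable {L : ℕ} [NeZero L]

omit [NeZero L] in
/-- `⟨toLp x, toLp y⟩ = x† y`. [folklore] -/
private theorem inner_toLp_toLp_eq' (x y : FockIdx L → ℂ) :
    ⟪(toLp 2 x : EuclideanSpace ℂ (FockIdx L)), toLp 2 y⟫_ℂ = star x ⬝ᵥ y := by
  rw [EuclideanSpace.inner_toLp_toLp, dotProduct_comm]

omit [NeZero L] in
/-- `‖toLp v‖² = Re v†v`. [folklore] -/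
private theorem norm_toLp_sq_eq' (v : FockIdx L → ℂ) :
    ‖(toLp 2 v : EuclideanSpace ℂ (FockIdx L))‖ ^ 2 = (star v ⬝ᵥ v).re := by
  rw [← inner_toLp_toLp_eq', ← inner_self_eq_norm_sq (𝕜 := ℂ)]
  rfl

omit [NeZero L] in
/-- A unit Fock vector is a unit vector of `EuclideanSpace`. [folklore] -/
private theorem norm_toLp_eq_one {v : FockIdx L → ℂ} (hv : star v ⬝ᵥ v = 1) :
    ‖(toLp 2 v : EuclideanSpace ℂ (FockIdx L))‖ = 1 := by
  have h2 : ‖(toLp 2 v : EuclideanSpace ℂ (FockIdx L))‖ ^ 2 = 1 := by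
    rw [norm_toLp_sq_eq', hv, Complex.one_re]
  have h0 : 0 ≤ ‖(toLp 2 v : EuclideanSpace ℂ (FockIdx L))‖ := norm_nonneg _
  nlinarith

/-- `|Λ| = L²`. [folklore] -/
private theorem card_torusSite_sq' : Fintype.card (TorusSite 2 L) = L ^ 2 := by
  simp [TorusSite, ZMod.card]

variable (U μ : ℝ)

/-- **KT93 Theorem 7.3 for the `d`-wave pair field of the 2D Hubbard model — ORDER form, ground-state
VECTORS, explicit threshold.**  For every level `s ∈ (0, 2K_d]` of pair long-range order
(`K_d = pairNormConst dWaveFormFactor = 4√2`), every field `B > 0` and `ε > 0` there is `L₀` such that for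
all `L ≥ L₀`: if the grand-canonical torus Hamiltonian `H(1,U) - μN` on `(ℤ/Lℤ)²` has a normalised
ground-state vector `Φ` which is a particle-number eigenvector (`NΦ = νΦ`) with
`(s·L²)² ≤ Re Φ†(Δ_d+Δ_d†)²Φ`, then EVERY normalised ground-state vector `Φ_B` of the sourced Hamiltonian
`dWaveSourceTorus L U μ B = H(1,U) - μN - B(Δ_d+Δ_d†)` has `Re Φ_B†(Δ_d+Δ_d†)Φ_B / L² ≥ √2·s - ε`
(KT93 (7.11) with `σ_Λ = s`, volume limit first). [cite: KomaTasaki1993, Theorem 7.3 (7.11)]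
[cite: KomaTasaki1994, §3.3, Theorem 2.5 (2.30)] -/
theorem re_pairOrder_groundStateVector_ge_of_pairLRO (s B ε : ℝ) (hs : 0 < s)
    (hsK : s ≤ 2 * pairNormConst dWaveFormFactor) (hB : 0 < B) (hε : 0 < ε) :
    ∃ L₀ : ℕ, ∀ (L : ℕ) [NeZero L], L₀ ≤ L →
      ∀ (Φ : FockIdx L → ℂ) (ν : ℂ), star Φ ⬝ᵥ Φ = 1 →
        (hubbardTorusWith 2 L 1 U μ).IsGroundStateVector Φ → totalNumber *ᵥ Φ = ν • Φ →
        (s * (L : ℝ) ^ 2) ^ 2 ≤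
          (star Φ ⬝ᵥ ((pairField dWaveFormFactor L + (pairField dWaveFormFactor L)ᴴ) *ᵥ
            ((pairField dWaveFormFactor L + (pairField dWaveFormFactor L)ᴴ) *ᵥ Φ))).re →
        ∀ (ΦB : FockIdx L → ℂ), star ΦB ⬝ᵥ ΦB = 1 →
          (dWaveSourceTorus L U μ B).IsGroundStateVector ΦB →
          Real.sqrt 2 * s - ε ≤
            (star ΦB ⬝ᵥ ((pairField dWaveFormFactor L + (pairField dWaveFormFactor L)ᴴ) *ᵥ ΦB)).re
              / (L : ℝ) ^ 2 := by
  set K : ℝ := pairNormConst dWaveFormFactor with hKdef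
  have hK : 0 < K := pairNormConst_dWave_pos
  -- the LRO parameter `μ′ = s/(2K) ∈ (0,1]`
  set μ' : ℝ := s / (2 * K) with hμ'def
  have hμ' : 0 < μ' := by positivity
  have hμ'1 : μ' ≤ 1 := by rw [hμ'def, div_le_one (by positivity)]; exact hsK
  have hsμ : μ' * (2 * K) = s := by rw [hμ'def]; field_simp
  obtain ⟨N₀, hN₀⟩ := komaTasakiU1Field_holds.{0, 0} μ' (2 * K) (45 * (2 * |(1 : ℝ)| + |U| + 2 * |μ|))
    25 25 B ε hB hε
  refine ⟨N₀, fun L _ hL Φ ν hΦ1 hgs hN hlro ΦB hΦB1 hgsB => ?_⟩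
  have hL2 : N₀ ≤ Fintype.card (TorusSite 2 L) := by
    rw [card_torusSite_sq']
    exact hL.trans (Nat.le_self_pow two_ne_zero L)
  set sys := dWaveKTSystem L 1 U μ dWaveFormFactor pairNormConst_dWave_pos with hsys
  -- hypothesis iv)
  have hlro' : (μ' * (2 * pairNormConst dWaveFormFactor) * (L : ℝ) ^ 2) ^ 2 ≤
      (star Φ ⬝ᵥ ((pairField dWaveFormFactor L + (pairField dWaveFormFactor L)ᴴ) *ᵥ
        ((pairField dWaveFormFactor L + (pairField dWaveFormFactor L)ᴴ) *ᵥ Φ))).re := by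
    rw [← hKdef, hsμ]; exact hlro
  have hΦ' := dWaveKTSystem_isLROEigenstate (L := L) 1 U μ dWaveFormFactor pairNormConst_dWave_pos
    hΦ1 hgs.2 hN hμ' hμ'1 hlro'
  -- ground-state property of `Φ` (`E = E₀`)
  have hground : ∀ ψ : EuclideanSpace ℂ (FockIdx L), ‖ψ‖ = 1 →
      (hubbardTorusWith 2 L 1 U μ).groundEnergy ≤ (⟪ψ, sys.hamiltonian ψ⟫_ℂ).re := by
    intro ψ hψ
    rw [hsys, dWaveKTSystem_hamiltonian]
    exact groundEnergy_le_re_inner_toEuclideanCLM (isHermitian_hubbardTorusWith L 1 U μ) ψ hψ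
  -- ground-state property of `Φ_B`
  have hKB : (hubbardTorusWith 2 L 1 U μ -
      (B : ℂ) • (pairField dWaveFormFactor L + (pairField dWaveFormFactor L)ᴴ)).IsHermitian := by
    rw [← dWaveSourceTorus_eq_sub]; exact dWaveSourceTorus_isHermitian L (isHermitian_hubbardTorusWith L 1 U μ) B
  have hmin : ∀ ψ : EuclideanSpace ℂ (FockIdx L), ‖ψ‖ = 1 →
      (⟪(toLp 2 ΦB : EuclideanSpace ℂ (FockIdx L)),
          (sys.hamiltonian - (B : ℂ) • sys.order 0) (toLp 2 ΦB)⟫_ℂ).re ≤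
        (⟪ψ, (sys.hamiltonian - (B : ℂ) • sys.order 0) ψ⟫_ℂ).re := by
    intro ψ hψ
    rw [hsys, dWaveKTSystem_field]
    have hgsB' := hgsB.2
    rw [dWaveSourceTorus_eq_sub] at hgsB'
    exact re_inner_le_of_groundState hKB hΦB1 hgsB' ψ hψ
  have h := hN₀ sys (toLp 2 Φ) (hubbardTorusWith 2 L 1 U μ).groundEnergy hΦ' rfl le_rfl le_rfl
    le_rfl hground hL2 (toLp 2 ΦB) (norm_toLp_eq_one hΦB1) hmin
  -- read the conclusion in matrix terms
  rw [hsys, dWaveKTSystem_order_zero, toEuclideanCLM_toLp, inner_toLp_toLp_eq', card_torusSite_sq',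
    Nat.cast_pow] at h
  have e : Real.sqrt 2 * μ' * (2 * K) = Real.sqrt 2 * s := by rw [mul_assoc, hsμ]
  rw [e] at h
  exact h

set_option maxHeartbeats 400000 in
/-- **KT93 Theorem 7.3 for the `d`-wave pair field — TRACIAL form (the tree's order-parameter density
`dWaveSourceDensity`), explicit threshold.**  For every `s ∈ (0, 2K_d]`, `B > 0`, `ε > 0` there is `L₀`
such that for all `L ≥ L₀`: if `H(1,U) - μN` on `(ℤ/Lℤ)²` has a normalised particle-number-eigenvector
ground state `Φ` with pair long-range order `(s·L²)² ≤ Re Φ†(Δ_d+Δ_d†)²Φ`, then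
`2 · dWaveSourceDensity L U μ B ≥ √2·s - ε` — i.e. the finite-volume Koma–Tasaki order parameter
`m_L(B) = Re ω_B(Δ_d)/L²` (tracial ground state of `dWaveSourceTorus L U μ B`) is at least `s/√2 - ε/2`.
Route: ENERGY form (7.4)+(7.24) (`U1OverlapSystem.field_energy_le_of_card_ge`) + variational principle for
`E_L(B)` + the concavity sandwich `E_L(0) - E_L(B) ≤ B·Re ω_B(Δ_d+Δ_d†)` (`GroundStateSourceBounds`).
[cite: KomaTasaki1993, Theorem 7.3 (7.11), proof (7.4)–(7.5)] [cite: KomaTasaki1994, §1, §3.3] -/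
theorem two_mul_dWaveSourceDensity_ge_of_pairLRO (s B ε : ℝ) (hs : 0 < s)
    (hsK : s ≤ 2 * pairNormConst dWaveFormFactor) (hB : 0 < B) (hε : 0 < ε) :
    ∃ L₀ : ℕ, ∀ (L : ℕ) [NeZero L], L₀ ≤ L →
      ∀ (Φ : FockIdx L → ℂ) (ν : ℂ), star Φ ⬝ᵥ Φ = 1 →
        (hubbardTorusWith 2 L 1 U μ).IsGroundStateVector Φ → totalNumber *ᵥ Φ = ν • Φ →
        (s * (L : ℝ) ^ 2) ^ 2 ≤
          (star Φ ⬝ᵥ ((pairField dWaveFormFactor L + (pairField dWaveFormFactor L)ᴴ) *ᵥ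
            ((pairField dWaveFormFactor L + (pairField dWaveFormFactor L)ᴴ) *ᵥ Φ))).re →
        Real.sqrt 2 * s - ε ≤ 2 * dWaveSourceDensity L U μ B := by
  set K : ℝ := pairNormConst dWaveFormFactor with hKdef
  have hK : 0 < K := pairNormConst_dWave_pos
  set μ' : ℝ := s / (2 * K) with hμ'def
  have hμ' : 0 < μ' := by positivity
  have hμ'1 : μ' ≤ 1 := by rw [hμ'def, div_le_one (by positivity)]; exact hsK
  have hsμ : μ' * (2 * K) = s := by rw [hμ'def]; field_simp
  -- `k` from the trial-state half with `ε/2`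
  obtain ⟨k₀, hk₀⟩ := theorem_2_5_orderOne_overlap_holds.{0, 0} μ' (2 * K) (ε / 2) 25 (half_pos hε)
  obtain ⟨N₁, hN₁⟩ := hk₀ (max k₀ 1) (le_max_left _ _)
  set k : ℕ := max k₀ 1 with hk_def
  have hk1 : 1 ≤ k := le_max_right _ _
  -- the constant `D_k` of the class and the thresholds
  set h₀ : ℝ := 45 * (2 * |(1 : ℝ)| + |U| + 2 * |μ|) with hh₀def
  have hh₀ : 0 ≤ h₀ := by positivity
  set D : ℝ := (k : ℝ) * 2 ^ (k + 1) * h₀ * 25 / μ' ^ k with hD_def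
  have hD0 : 0 ≤ D := by positivity
  set N₂ : ℕ := ⌈(k : ℝ) ^ 2 * 25 * 2 ^ k / μ' ^ (2 * k)⌉₊ with hN₂_def
  set N₃ : ℕ := ⌈2 * D / (B * ε)⌉₊ with hN₃_def
  refine ⟨max N₁ (max N₂ N₃), fun L _ hL Φ ν hΦ1 hgs hN hlro => ?_⟩
  -- `N = L² ≥ L ≥ thresholds`
  have hLN : (L : ℝ) ≤ (L : ℝ) ^ 2 := by exact_mod_cast Nat.le_self_pow two_ne_zero L
  have hN0 : (0 : ℝ) < (L : ℝ) ^ 2 := by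
    have : (0 : ℝ) < L := by exact_mod_cast Nat.pos_of_ne_zero (NeZero.ne L)
    positivity
  have hLr : ((max N₁ (max N₂ N₃) : ℕ) : ℝ) ≤ L := by exact_mod_cast hL
  have hNle1 : N₁ ≤ Fintype.card (TorusSite 2 L) := by
    rw [card_torusSite_sq']
    exact (le_trans (le_max_left _ _) hL).trans (Nat.le_self_pow two_ne_zero L)
  have hNle2 : (N₂ : ℝ) ≤ (L : ℝ) ^ 2 :=
    le_trans (le_trans (by exact_mod_cast le_trans (le_max_left _ _) (le_max_right _ _)) hLr) hLN
  have hNle3 : (N₃ : ℝ) ≤ (L : ℝ) ^ 2 :=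
    le_trans (le_trans (by exact_mod_cast le_trans (le_max_right _ _) (le_max_right _ _)) hLr) hLN
  set sys := dWaveKTSystem L 1 U μ dWaveFormFactor pairNormConst_dWave_pos with hsys
  -- hypothesis iv)
  have hlro' : (μ' * (2 * pairNormConst dWaveFormFactor) * (L : ℝ) ^ 2) ^ 2 ≤
      (star Φ ⬝ᵥ ((pairField dWaveFormFactor L + (pairField dWaveFormFactor L)ᴴ) *ᵥ
        ((pairField dWaveFormFactor L + (pairField dWaveFormFactor L)ᴴ) *ᵥ Φ))).re := by
    rw [← hKdef, hsμ]; exact hlro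
  have hΦ' := dWaveKTSystem_isLROEigenstate (L := L) 1 U μ dWaveFormFactor pairNormConst_dWave_pos
    hΦ1 hgs.2 hN hμ' hμ'1 hlro'
  -- the size condition (`r′ = 25`, `N = L²`)
  have hsize : (k : ℝ) ^ 2 * sys.r' * 2 ^ k ≤ μ' ^ (2 * k) * Fintype.card (TorusSite 2 L) := by
    rw [hsys, dWaveKTSystem_r', card_torusSite_sq', Nat.cast_pow]
    have hμk : 0 < μ' ^ (2 * k) := pow_pos hμ' _
    have h1 : (k : ℝ) ^ 2 * 25 * 2 ^ k / μ' ^ (2 * k) ≤ (L : ℝ) ^ 2 := (Nat.le_ceil _).trans hNle2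
    rw [div_le_iff₀ hμk] at h1
    push_cast
    linarith
  -- the energy form (7.4)+(7.24) for the field `B`
  obtain ⟨hΞ1, hEΞ⟩ := sys.field_energy_le_of_card_ge hΦ' hk1 hsize B
  -- variational principle for `E_L(B)`
  have hKh : (hubbardTorusWith 2 L 1 U μ).IsHermitian := isHermitian_hubbardTorusWith L 1 U μ
  have hOh : (pairField dWaveFormFactor L + (pairField dWaveFormFactor L)ᴴ).IsHermitian :=
    isHermitian_pairField_add_conjTranspose L
  have hKB : (hubbardTorusWith 2 L 1 U μ -
      (B : ℂ) • (pairField dWaveFormFactor L + (pairField dWaveFormFactor L)ᴴ)).IsHermitian := by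
    rw [← dWaveSourceTorus_eq_sub]
    exact dWaveSourceTorus_isHermitian L (isHermitian_hubbardTorusWith L 1 U μ) B
  have hvar := groundEnergy_le_re_inner_toEuclideanCLM hKB (sys.xiState k (toLp 2 Φ)) hΞ1
  rw [← dWaveKTSystem_field (L := L) 1 U μ dWaveFormFactor pairNormConst_dWave_pos B, ← hsys] at hvar
  -- the concavity sandwich `E_L(0) - E_L(B) ≤ B · Re ω_B(Δ+Δ†)`
  have hsw := sub_groundEnergy_le_sub_mul_re_groundStateFunctional hKh hOh B 0
  rw [Complex.ofReal_zero, zero_smul, sub_zero, sub_zero] at hsw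
  -- `Re ω_B(Δ+Δ†) = 2 L² m_L(B)` (the tree lemma, up to the `DecidableEq` instance inside `ω`)
  have hω : ((hubbardTorusWith 2 L 1 U μ -
      (B : ℂ) • (pairField dWaveFormFactor L + (pairField dWaveFormFactor L)ᴴ)).groundStateFunctional
        (pairField dWaveFormFactor L + (pairField dWaveFormFactor L)ᴴ)).re =
      2 * (L : ℝ) ^ 2 * dWaveSourceDensity L U μ B := by
    have h := re_groundStateFunctional_dWaveSource_op L U μ B
    rw [dWaveSourceTorus_eq_sub] at h
    convert h
  rw [hω] at hsw
  -- the trial-state half: `x ≥ (√2 s - ε/2) L²`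
  have hx := hN₁ sys (toLp 2 Φ) (hubbardTorusWith 2 L 1 U μ).groundEnergy hΦ' rfl le_rfl hNle1
  rw [card_torusSite_sq', Nat.cast_pow, le_div_iff₀ hN0] at hx
  -- `D_sys = D ≤ (Bε/2) L²`
  have hDsys : (k : ℝ) * 2 ^ (k + 1) * sys.hbar * sys.r / μ' ^ k = D := by
    rw [hsys, dWaveKTSystem_hbar, dWaveKTSystem_r, hD_def, hh₀def]
    norm_num
  rw [hDsys] at hEΞ
  have hDN : D ≤ B * ε / 2 * (L : ℝ) ^ 2 := by
    have h1 : 2 * D / (B * ε) ≤ (L : ℝ) ^ 2 := (Nat.le_ceil _).trans hNle3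
    rw [div_le_iff₀ (mul_pos hB hε)] at h1
    linarith
  -- assemble
  have e : Real.sqrt 2 * μ' * (2 * K) = Real.sqrt 2 * s := by rw [mul_assoc, hsμ]
  rw [e] at hx
  -- (linear bookkeeping only: the one product needed is `B · hx`)
  have hBx := mul_le_mul_of_nonneg_left hx hB.le
  have key : B * ((Real.sqrt 2 * s - ε) * (L : ℝ) ^ 2) ≤
      B * ((2 * dWaveSourceDensity L U μ B) * (L : ℝ) ^ 2) := by
    linarith [hvar, hEΞ, hsw, hBx, hDN]
  exact le_of_mul_le_mul_right (le_of_mul_le_mul_left key hB) hN0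

/-- **KT93 Theorem 7.3 for the `d`-wave pair field — the tree's Koma–Tasaki ORDER PARAMETER.**  If along
the tori `(ℤ/(L+1)ℤ)²`, eventually in `L`, the grand-canonical Hamiltonian `H(1,U) - μN` has a normalised
particle-number-eigenvector ground state with pair long-range order `(s·(L+1)²)² ≤ Re Φ†(Δ_d+Δ_d†)²Φ`
(`0 < s ≤ 2K_d`), then `dWaveOrderParameter U μ ≥ s/√2` (`= liminf_{h↓0} liminf_L m_{L+1}(h)`; volume
limit first).  Read contrapositively this is the KT-direction CEILING on ground-state pair LRO from the
sourced order parameter: `s ≤ √2 · m*`. [cite: KomaTasaki1993, Theorem 7.3 (7.11)]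
[cite: KomaTasaki1994, §1 (0.2), Theorem 2.5 (2.30), Corollary 2.9] -/
theorem le_dWaveOrderParameter_of_pairLRO (s : ℝ) (hs : 0 < s)
    (hsK : s ≤ 2 * pairNormConst dWaveFormFactor)
    (hLRO : ∀ᶠ L : ℕ in atTop, ∃ (Φ : FockIdx (L + 1) → ℂ) (ν : ℂ), star Φ ⬝ᵥ Φ = 1 ∧
      (hubbardTorusWith 2 (L + 1) 1 U μ).IsGroundStateVector Φ ∧ totalNumber *ᵥ Φ = ν • Φ ∧
      (s * ((L + 1 : ℕ) : ℝ) ^ 2) ^ 2 ≤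
        (star Φ ⬝ᵥ ((pairField dWaveFormFactor (L + 1) + (pairField dWaveFormFactor (L + 1))ᴴ) *ᵥ
          ((pairField dWaveFormFactor (L + 1) + (pairField dWaveFormFactor (L + 1))ᴴ) *ᵥ Φ))).re) :
    Real.sqrt 2 * s / 2 ≤ dWaveOrderParameter U μ := by
  rw [le_dWaveOrderParameter_iff_forall]
  intro h hh
  refine le_of_forall_sub_le fun ε hε => ?_
  obtain ⟨L₀, hL₀⟩ := two_mul_dWaveSourceDensity_ge_of_pairLRO U μ s h (2 * ε) hs hsK hh (by positivity)
  refine le_liminf_of_le (isCoboundedUnder_ge_of_eventually_le _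
    (x := 2 * ∑ e ∈ insert (0 : Site 2) unitSteps, |dWaveFormFactor e / Real.sqrt 2|) ?_) ?_
  · exact Eventually.of_forall fun L => dWaveSourceDensity_le_const (L + 1) U μ h
  · filter_upwards [hLRO, eventually_ge_atTop L₀] with L hL hLge
    obtain ⟨Φ, ν, hΦ1, hgs, hN, hlro⟩ := hL
    have h2 := hL₀ (L + 1) (Nat.le_succ_of_le hLge) Φ ν hΦ1 hgs hN hlro
    linarith

end DWaveField

end Literature.MathematicalPhysics.QuantumLattice
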